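import Summits.BirchSwinnertonDyer.BirchSwinnertonDyer.Theses.KatoDescentTamePotSupersingular
import Summits.BirchSwinnertonDyer.BirchSwinnertonDyer.Theorems.KatoDescentTamePotSupersingularTameUpperOptimalSharpNodesJ08S2MD
import Summits.BirchSwinnertonDyer.BirchSwinnertonDyer.Theorems.KatoDescentPotSupersingularReducibleUpperOfCountInputsNodes
import Summits.BirchSwinnertonDyer.BirchSwinnertonDyer.Theorems.KatoDescentTamePotSupersingularJetchevIrreducibleReadingTwoSplit
import HarnessLib

/-!
# Route `KatoDescentTamePotSupersingular` (rung K8, sub-rung B4 (t′), cell `bsd-potss`): the U₀-ns node `TameUpperNonsurjTower`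
# (item 19202) and the U₀ parent `TameUpperDefectRankZero` (item 19982) BY NAME from FOUR NAMED LITERATURE FACTS, the route's
# HELD published inputs, and exactly TWO open mathematical nodes of the route — NO Jetchev reading, NO L₀

Seat `bsd-potss-k8t-c4` g13 (composition of this seat's L₀-free node body
`TameUpperOptimalSharpNodesJ08S2MD.upperNonsurjTower_of_jetchev08TwoSplit_of_cruxAResidue_of_maninDrinfeld` with k9-c4 g11's
`JetchevIrreducibleSwapAtP.cor15_irreducibleReadingTwoSplit_of_namedFacts`; sibling of `…TameUpperNonsurjTowerOfOptimalSharpRoadJ08S2`,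
which records the same nodes over the displayed schema `hJ2`); `--supports stmt-BirchSwinnertonDyer-19982`, helper;
imports the route file (and, through k9-c4's reading file, the capstone `…JetchevIrreducibleReadingOfStubs`); CONDITIONAL
(conditional-result: the gate records the named-fact hypotheses and the open route nodes); NOTHING is closed; BSD is not proved
by any of this.

The four named facts (all `def … : Prop` in `Literature/`, cite-level, no `_holds`):
* S1 — `MatarNekovar2019.thm07_padicValNat_card_sha_primary_add_le_of_globalDivisibility_of_irreducible` (Kolyvagin's structure
  theorem, upper half, irreducible reading, no reduction binder at `p`; Matar–Nekovář 2019 Thm. 0.7 + §0.11; flag composite);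
* `GrossLMS1991.prop37_2_frobeniusCongruence` (Gross 1991 Prop. 3.7 (2) = Nekovář 2007 Prop. 4.9 / 4.13 (ii));
* `poitouTate_selmerStructure_duality_conj` (Poitou–Tate duality for the tree's Selmer structures; Milne ADT I Thm. 4.10);
* `Gross1991_heegnerPoint_sub_ratTorsion_mem_E0_imageFree` ([GZ86 III (3.1)] / Gross 1991 §6, image-free).
The held route inputs: `PublishedInputsHeegner` (GZ86, Kolyvagin, Matar–Nekovář 0.3, newforms, Bump–Friedberg–Hoffstein), Cassels
(`PublishedInputCasselsIsogenyRedT`), `KatoTamagawaExactInputs` (A161″, GZK, modularity), `PublishedInputsFineSelmerCM` (Kato's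
fine-Selmer reading, Burungale–Flach), and for 19982 the U₀-red COUNT inputs (`PublishedInputNewformKatoRedT`,
`PublishedInputMemberHullCountInputsT`, `PublishedInputRankEqAnalyticRankRedT`, `PublishedInputEntireLFunctionRedT`;
`PublishedInputIwasawaH1DataRedT` is a tree theorem). The two OPEN nodes: the auto-crux `TameCoatesSujathaResidue` (Coates–Sujatha
(A) on the residue rows: optimal Manin constant divisible by `p`, or ≥ 2 multiplicative Tamagawa carriers) and the residual
`TameRankOne` (used only through its LOWER half at the rank-one (t′) twists). The Jetchev reading (crux 20165) is REPLACED by its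
two-split form, a theorem of the four facts (k9-c4 g11); L₀ `TameLowerHalfRankZero` is REPLACED by Manin–Drinfeld (tree theorem,
this seat's `…TameUpperOptimalSharpNodesJ08S2MD`).

References: [Jetchev2008] Thm. 1.4, Cor. 1.5 (p. 3 = printed p. 812), Rem. 6.2; [MatarNekovar2019] Thm. 0.3, Thm. 0.7, §0.11
(pp. 456–457); [GrossLMS1991] Prop. 3.7 (2) (p. 240), §6; [GrossZagier1986] I.6.3, III (3.1); [MilneADT2006] I Thm. 4.10, Thm. I.7.3;
[BumpFriedbergHoffstein1990] Theorem (pp. 543–544); [Manin1972] Cor. 3.6; [Kato2004Asterisque] Thm. 12.6, Thm. 14.5 (3) (p. 236),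
Prop. 14.16 (2); [CoatesSujatha2005] Conj. A; [BurungaleFlach2024] Cor. 2.
-/

set_option autoImplicit false
-- the Theorems directory repeats the summit name (sibling precedent `KatoDescentPotSupersingularAssembly.lean`)
set_option linter.dupNamespace false

noncomputable section

open scoped Classical NumberField

namespace Summit.BirchSwinnertonDyer.BirchSwinnertonDyer.Theorems.TameUpperNonsurjTowerOfNamedFacts

open WeierstrassCurve NumberField Literature.NumberTheory.EllipticCurves
  Literature.NumberTheory.EllipticCurves.ModularForms
  Literature.NumberTheory.EllipticCurves.Rank1Residual
  Literature.NumberTheory.EllipticCurves.Rank1Residual.Typed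
  Literature.NumberTheory.GaloisCohomology
  Summit.BirchSwinnertonDyer.Rank1Residual Summit.BirchSwinnertonDyer.Rank1Residual.Additive
  Summit.BirchSwinnertonDyer.BirchSwinnertonDyer.Theses.KatoDescentTamePotSupersingular
  Summit.BirchSwinnertonDyer.BirchSwinnertonDyer.Theorems

/-! ### §0 Route-free re-derivations of the two closed glue compositions (private; no theses-cone import beyond the route) -/

/-- The closed glue 19204 (`tameUpperDefectOfSplit_proof`) re-derived over the route-free kernel
`X4RankZero.missingUpperBoundAt_of_katoTam`. [cite: Kato2004Asterisque, Thm. 14.5 (3) (p. 236), Prop. 14.16 (2) (p. 244)] -/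
private theorem tameUpperDefectRankZero_of_nonsurj_of_red (a91 : KatoTamagawaExactInputs) (hns : TameUpperNonsurjTower)
    (hred : TameUpperReducibleDefect) : TameUpperDefectRankZero := by
  obtain ⟨hKatoT, hGZK, hmod⟩ := a91
  intro W _ _ p _ hr hp2 hadd hT hcov
  by_cases hI : W.HasIrreducibleModPGaloisRep p
  · by_cases hsurj : ∀ n : ℕ, W.HasSurjectiveModNGaloisRep (p ^ n : ℕ)
    · have hO5 : ClassO5 W p := ⟨hp2, hadd, Or.inr hT⟩
      exact X4RankZero.missingUpperBoundAt_of_katoTam W p hKatoT hGZK hmod hr ⟨hp2, hadd, hI⟩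
        hO5.padicValRat_j_nonneg hsurj
    · exact hns W p hr hp2 hadd hT hI hsurj
  · exact hred W p hr hp2 hadd hT hI (fun h ↦ hcov (Or.inr ⟨hI, h⟩))

/-- The closed glue 19712 (`tameUpperReducibleDefectOfCountInputs_proof`) re-derived over the route-free kernel
`ReducibleUpperOfCountInputs.missingUpperBoundAt_of_memberCountInputs` (`𝐇¹` input = the tree theorem
`PublishedInputIwasawaH1DataRedT_holds`). [cite: Kato2004Asterisque, proof of Prop. 14.16 (pp. 244–245)] -/
private theorem tameUpperReducibleDefect_of_countInputs (hNK : PublishedInputNewformKatoRedT)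
    (hHC : PublishedInputMemberHullCountInputsT) (hC₄ : PublishedInputCasselsIsogenyRedT)
    (hGZK : PublishedInputRankEqAnalyticRankRedT) (hMod : PublishedInputEntireLFunctionRedT) :
    TameUpperReducibleDefect :=
  fun W _ _ p _ hr hp hadd hT hred _ ↦
    have hO5 : ClassO5 W p := ⟨hp, hadd, Or.inr hT⟩
    ReducibleUpperOfCountInputs.missingUpperBoundAt_of_memberCountInputs PublishedInputIwasawaH1DataRedT_holds hNK hHC
      hC₄ hGZK hMod W p hp hadd.1 hadd.2 hO5.padicValRat_j_nonneg hred hr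

/-! ### §1 The two items BY NAME from the four named facts -/

/-- **The U₀-ns node `TameUpperNonsurjTower` (item 19202) BY NAME from the four named facts {S1 = MN19 Thm. 0.7, Gross 3.7 (2),
Poitou–Tate, GZ86 III (3.1)}, the held `PublishedInputsHeegner` / Cassels / `KatoTamagawaExactInputs` / `PublishedInputsFineSelmerCM`,
and the two open nodes `TameCoatesSujathaResidue`, `TameRankOne` — no Jetchev reading, no L₀.** The two-split reading is k9-c4 g11's
`JetchevIrreducibleSwapAtP.cor15_irreducibleReadingTwoSplit_of_namedFacts` (Kolyvagin and newforms are conjuncts 2 and 4 of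
`PublishedInputsHeegner`); the node body over it, L₀-free, is this seat's
`TameUpperOptimalSharpNodesJ08S2MD.upperNonsurjTower_of_jetchev08TwoSplit_of_cruxAResidue_of_maninDrinfeld`. CONDITIONAL; closes nothing.
[cite: Jetchev2008, Cor. 1.5 (p. 812)] [cite: MatarNekovar2019, Thm. 0.7, §0.11 (p. 457)] [cite: GrossLMS1991, Prop. 3.7 (2) (p. 240)]
[cite: Manin1972, Cor. 3.6] -/
theorem tameUpperNonsurjTower_of_structureIrred_of_namedFacts
    (hS1 : MatarNekovar2019.thm07_padicValNat_card_sha_primary_add_le_of_globalDivisibility_of_irreducible)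
    (h37 : GrossLMS1991.prop37_2_frobeniusCongruence)
    (hPT : ∀ (K : Type) [Field K] [NumberField K], poitouTate_selmerStructure_duality_conj K)
    (hF1 : Gross1991_heegnerPoint_sub_ratTorsion_mem_E0_imageFree)
    (hH : PublishedInputsHeegner) (hC₄ : PublishedInputCasselsIsogenyRedT) (hCS : TameCoatesSujathaResidue)
    (a84 : TameRankOne) (a91 : KatoTamagawaExactInputs) (a87 : PublishedInputsFineSelmerCM) : TameUpperNonsurjTower :=
  TameUpperOptimalSharpNodesJ08S2MD.upperNonsurjTower_of_jetchev08TwoSplit_of_cruxAResidue_of_maninDrinfeld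
    (JetchevIrreducibleSwapAtP.cor15_irreducibleReadingTwoSplit_of_namedFacts hS1 h37 hPT hF1 hH.2.1 hH.2.2.2.1)
    hH.1 hH.2.1 hH.2.2.1 hH.2.2.2.1 hH.2.2.2.2 hC₄ hCS a84 a91 a87

/-- **Item 19982 `TameUpperDefectRankZero` BY NAME from the four named facts, the route's held published inputs, and exactly two
open nodes (`TameCoatesSujathaResidue`, `TameRankOne`)** — the U₀ bill of (t′), v8: no Jetchev reading (two-split form ⟸ the
four facts), no L₀ (Manin–Drinfeld), U₀-red from Kato's COUNT inputs. CONDITIONAL; closes nothing; BSD is proved for no curve.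
[cite: Jetchev2008, Cor. 1.5 (p. 812)] [cite: MatarNekovar2019, Thm. 0.7, §0.11 (p. 457)]
[cite: Kato2004Asterisque, Thm. 12.6, Thm. 14.5 (3) (p. 236), Prop. 14.16 (2)] [cite: MilneADT2006, Thm. I.7.3] -/
theorem tameUpperDefectRankZero_of_structureIrred_of_namedFacts_of_countInputs
    (hS1 : MatarNekovar2019.thm07_padicValNat_card_sha_primary_add_le_of_globalDivisibility_of_irreducible)
    (h37 : GrossLMS1991.prop37_2_frobeniusCongruence)
    (hPT : ∀ (K : Type) [Field K] [NumberField K], poitouTate_selmerStructure_duality_conj K)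
    (hF1 : Gross1991_heegnerPoint_sub_ratTorsion_mem_E0_imageFree)
    (hH : PublishedInputsHeegner) (hC₄ : PublishedInputCasselsIsogenyRedT) (a91 : KatoTamagawaExactInputs)
    (a87 : PublishedInputsFineSelmerCM) (hNK : PublishedInputNewformKatoRedT) (hHC : PublishedInputMemberHullCountInputsT)
    (hGZK : PublishedInputRankEqAnalyticRankRedT) (hMod : PublishedInputEntireLFunctionRedT)
    (hCS : TameCoatesSujathaResidue) (a84 : TameRankOne) : TameUpperDefectRankZero :=
  tameUpperDefectRankZero_of_nonsurj_of_red a91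
    (tameUpperNonsurjTower_of_structureIrred_of_namedFacts hS1 h37 hPT hF1 hH hC₄ hCS a84 a91 a87)
    (tameUpperReducibleDefect_of_countInputs hNK hHC hC₄ hGZK hMod)

end Summit.BirchSwinnertonDyer.BirchSwinnertonDyer.Theorems.TameUpperNonsurjTowerOfNamedFacts

end
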